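import Mathlib
import Literature.Analysis.FluidPDE.Tao2016AveragedNS.BoundedEternalSolutions
import Summits.NavierStokesRegularity.NavierStokesRegularity.Theses.TaoLadderRungTwoBreak
import Summits.NavierStokesRegularity.NavierStokesRegularity.Theorems.TaoLadderRungTwoBreakNoSurvivingEternalViscBddOneUpwardFluxVisc
import Summits.NavierStokesRegularity.NavierStokesRegularity.Theorems.WakeRatchetAdmissibleEternalBoundOrthantBound
import HarnessLib

/-!
# K1ᵛ(1) `TaoLadderRungTwoBreak.NoSurvivingEternalViscBddOne` (stmt-NavierStokesRegularity-20419): the a=1-WEIGHTED TOTAL-THROUGHPUT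
# CRITERION on the sign-coherent class (no action hypothesis)

MODEL lattice ODEs only (Tao 2016 §4, log-time variables §6.4); nothing here is a statement about the Navier–Stokes equations; no stub,
crux or summit is closed (`--supports stmt-NavierStokesRegularity-20419`).

The tree's upward-flux rung (`…UpwardFluxRung`, `…UpwardFluxVisc`) kills forward (S₁)-survival on the SIGN-COHERENT class (all bond
fluxes `F_j ≥ 0`; it contains every admissible eternal solution of a strong-orthant table, in particular of the dyadic member) under a
LOGARITHMIC ACTION budget, through the geometric decay of the total bond throughputs `Φ_n = ∫_ℝ F_n`.  This file records the bare
criterion behind it, with NO action hypothesis and NO rate: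

* `not_survivingFwd_of_weightedThroughput_tendsto_zero` — if the a=1-weighted total throughputs `(1+ε₀)^{n+1} Φ_n` tend to `0`, the
  solution is not forward (S₁)-surviving (any `ν̂ ≥ 0`): `(1+ε₀)^{n+1} E_{n+1}(σ) ≤ (1+ε₀)^{n+1} Φ_n` at EVERY log-time
  (`physEnergy_le_throughput_visc`), so no late level `c > 0` survives;
* `frequently_weightedThroughput_ge_of_survivingFwd` — contrapositive floor: a surviving sign-coherent solution has
  `(1+ε₀)^{n+1} Φ_n ≥ c` for infinitely many bonds `n`;
* `orthant_not_survivingFwd_of_weightedThroughput_tendsto_zero` / `dyadic_not_survivingFwd_of_weightedThroughput_tendsto_zero` —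
  the same on strong-orthant tables of `InTableClass R` and on `dyadicTable`, where sign-coherence and (for `ν̂ = 0`) the uniform bound
  are automatic (`WakeRatchetOrthant.physFlux_nonneg`, `uniformBound_of_orthant`).

READING for the census of ⟨20419⟩ (with route WakeRatchet's total-flux identity `finalTail_eq_integral_physFlux`: `Φ_n` = the FINAL
TAIL above shell `n+1`): on the sign-coherent class, (ρ0) ⟸ «a=1-weighted final tails tend to zero», i.e. a wake-rate `a₀ > 1` plus
no conveyor mass; the numerics of this hand (evidence `NUMERICS-20419-wake-exponent-leafhand4-g0.md`) measure `a₀ ≈ 1.21…5/3` on the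
dyadic / pump members of E₂(2).  HONEST LABEL: bookkeeping over landed theorems; (ρ0), (ρ+), ⟨20419⟩ and every NS statement remain OPEN.
-/

noncomputable section

-- the summit and its single sub-problem share the name (CONVENTIONS §1)
set_option linter.dupNamespace false

namespace Summit.NavierStokesRegularity.NavierStokesRegularity.Theorems.NoSurvivingEternalViscBddOne.UpwardFlux

open Set Filter Topology MeasureTheory
open scoped RealInnerProductSpace
open Literature.Analysis.FluidPDE Literature.Analysis.FluidPDE.TaoCascade
open Summit.NavierStokesRegularity.NavierStokesRegularity.Theses.TaoLadderRungTwoBreak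
open Summit.NavierStokesRegularity.NavierStokesRegularity.Theorems.WakeRatchetOrthant
  (physFlux_nonneg quasiPositive_iff_strongOrthant uniformBound_of_orthant quasiPositive_dyadicTable)

variable {ε₀ νh : ℝ} {α : Fin 4 → Fin 4 → Fin 4 → ℤ × ℤ × ℤ → ℝ} {W : ℤ → ℝ → Em 4}

/-- **The a=1-weighted total-throughput criterion** (sign-coherent class, any `ν̂ ≥ 0`).  If every bond flux is non-negative and the
weighted total throughputs `(1+ε₀)^{n+1} ∫_ℝ F_n` tend to `0` as `n → ∞`, the solution is NOT forward (S₁)-surviving — at every log-time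
`(1+ε₀)^{n+1} E_{n+1}(σ) ≤ (1+ε₀)^{n+1} ∫_ℝ F_n`.
[cite: Tao2016AveragedNS, §4 Lemma 4.1 (4.8)–(4.10) with (4.3) and the viscous equation before Thm. 4.2, §6.4; tree `physEnergy_le_throughput_visc`] -/
theorem not_survivingFwd_of_weightedThroughput_tendsto_zero (hε : 0 < ε₀) (hW : IsEternalVisc ε₀ νh α W)
    (hc : IsCancellingCoeff α) (hU : UniformBound W) (hF : ∀ (j : ℤ) (s : ℝ), 0 ≤ physFlux ε₀ α W j s)
    (hΦ : Tendsto (fun n : ℕ => (1 + ε₀) ^ (n + 1) * ∫ s, physFlux ε₀ α W n s) atTop (𝓝 0)) :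
    ¬ EternalSurvivingFwd 1 ε₀ W := by
  rintro ⟨c, hc0, hcN⟩
  obtain ⟨N, hN⟩ : ∃ N : ℕ, ∀ n : ℕ, N ≤ n → (1 + ε₀) ^ (n + 1) * ∫ s, physFlux ε₀ α W n s < c :=
    eventually_atTop.1 (hΦ.eventually (gt_mem_nhds hc0))
  obtain ⟨n, hnN, σ, -, hcle⟩ := hcN (N + 1)
  obtain ⟨k, rfl⟩ : ∃ k : ℕ, n = k + 1 := ⟨n - 1, by omega⟩
  have hw : physWeight 1 ε₀ ^ (k + 1) * (Real.exp (2 * σ) * ‖W ((k + 1 : ℕ) : ℤ) σ‖ ^ 2)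
      = (1 + ε₀) ^ (k + 1) * physEnergy ε₀ W ((k + 1 : ℕ) : ℤ) σ := by
    have := wtEnergy_eq hε W (k + 1) σ; unfold wtEnergy at this; exact this
  rw [hw] at hcle
  have hcast : ((k + 1 : ℕ) : ℤ) = (k : ℤ) + 1 := by push_cast; ring
  rw [hcast] at hcle
  have h1 : physEnergy ε₀ W ((k : ℤ) + 1) σ ≤ ∫ s, physFlux ε₀ α W k s :=
    physEnergy_le_throughput_visc hε hW hc hU hF k σ
  have h2 : (1 + ε₀) ^ (k + 1) * physEnergy ε₀ W ((k : ℤ) + 1) σ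
      ≤ (1 + ε₀) ^ (k + 1) * ∫ s, physFlux ε₀ α W k s :=
    mul_le_mul_of_nonneg_left h1 (by positivity)
  have h3 := hN k (by omega)
  linarith

/-- **Throughput floor of a survivor** (contrapositive).  A forward (S₁)-surviving sign-coherent uniformly bounded admissible eternal
solution has `c ≤ (1+ε₀)^{n+1} ∫_ℝ F_n` for infinitely many bonds `n`, for some `c > 0`.
[cite: Tao2016AveragedNS, §4 Lemma 4.1 (4.8)–(4.10), §6.4; this file] -/
theorem frequently_weightedThroughput_ge_of_survivingFwd (hε : 0 < ε₀) (hW : IsEternalVisc ε₀ νh α W)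
    (hc : IsCancellingCoeff α) (hU : UniformBound W) (hF : ∀ (j : ℤ) (s : ℝ), 0 ≤ physFlux ε₀ α W j s)
    (hS : EternalSurvivingFwd 1 ε₀ W) :
    ∃ c : ℝ, 0 < c ∧ ∃ᶠ n : ℕ in atTop, c ≤ (1 + ε₀) ^ (n + 1) * ∫ s, physFlux ε₀ α W n s := by
  obtain ⟨c, hc0, hcN⟩ := hS
  refine ⟨c, hc0, frequently_atTop.2 fun N => ?_⟩
  obtain ⟨n, hnN, σ, -, hcle⟩ := hcN (N + 1)
  obtain ⟨k, rfl⟩ : ∃ k : ℕ, n = k + 1 := ⟨n - 1, by omega⟩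
  refine ⟨k, by omega, ?_⟩
  have hw : physWeight 1 ε₀ ^ (k + 1) * (Real.exp (2 * σ) * ‖W ((k + 1 : ℕ) : ℤ) σ‖ ^ 2)
      = (1 + ε₀) ^ (k + 1) * physEnergy ε₀ W ((k + 1 : ℕ) : ℤ) σ := by
    have := wtEnergy_eq hε W (k + 1) σ; unfold wtEnergy at this; exact this
  rw [hw] at hcle
  have hcast : ((k + 1 : ℕ) : ℤ) = (k : ℤ) + 1 := by push_cast; ring
  rw [hcast] at hcle
  have h1 : physEnergy ε₀ W ((k : ℤ) + 1) σ ≤ ∫ s, physFlux ε₀ α W k s :=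
    physEnergy_le_throughput_visc hε hW hc hU hF k σ
  have h2 : (1 + ε₀) ^ (k + 1) * physEnergy ε₀ W ((k : ℤ) + 1) σ
      ≤ (1 + ε₀) ^ (k + 1) * ∫ s, physFlux ε₀ α W k s :=
    mul_le_mul_of_nonneg_left h1 (by positivity)
  exact hcle.trans h2

/-- **Strong-orthant tables** (`InTableClass R`; every feed component `≥ 0`, in-shell components `≥ 0` on the coordinate hyperplanes,
diagonal back-reaction — the unconditional Kamke condition): for a uniformly bounded admissible eternal solution (any `ν̂ ≥ 0`) the
fluxes are automatically non-negative, so weighted total throughputs tending to zero kill forward (S₁)-survival.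
[cite: Tao2016AveragedNS, §1.2, §4 Lemma 4.1 (4.8)–(4.10), §6.4; tree `WakeRatchetOrthant.physFlux_nonneg`] -/
theorem orthant_not_survivingFwd_of_weightedThroughput_tendsto_zero {R : ℝ} (hε : 0 < ε₀)
    (hα : InTableClass R α)
    (hA : ∀ (i : Fin 4) (y : Em 4), 0 ≤ tableA α y i)
    (hQ : ∀ (i : Fin 4) (x : Em 4), x i = 0 → 0 ≤ tableQ α x i)
    (hB : ∀ (i : Fin 4) (z x : Em 4), x i = 0 → tableB α z x i = 0)
    (hW : IsEternalVisc ε₀ νh α W) (hU : UniformBound W)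
    (hΦ : Tendsto (fun n : ℕ => (1 + ε₀) ^ (n + 1) * ∫ s, physFlux ε₀ α W n s) atTop (𝓝 0)) :
    ¬ EternalSurvivingFwd 1 ε₀ W :=
  not_survivingFwd_of_weightedThroughput_tendsto_zero hε hW hα.2.1 hU
    (fun k s => physFlux_nonneg hε hW hA hQ hB k s) hΦ

/-- **The dyadic member** (`dyadicTable ∈ E₂(2)`, inviscid): an admissible eternal solution of the renormalised Katz–Pavlović chain whose
a=1-weighted total bond throughputs `(1+ε₀)^{n+1} ∫_ℝ F_n` tend to `0` is not forward (S₁)-surviving — sign-coherence and the uniform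
bound are automatic on this table.
[cite: Tao2016AveragedNS, §1.2 (the dyadic Katz–Pavlović system), §4, §6.4; BarbatoMorandinRomito2011, §3.1; this file] -/
theorem dyadic_not_survivingFwd_of_weightedThroughput_tendsto_zero (hε : 0 < ε₀) {W : ℤ → ℝ → Em 4}
    (hW : IsEternal ε₀ dyadicTable W)
    (hΦ : Tendsto (fun n : ℕ => (1 + ε₀) ^ (n + 1) * ∫ s, physFlux ε₀ dyadicTable W n s) atTop (𝓝 0)) :
    ¬ EternalSurvivingFwd 1 ε₀ W := by
  obtain ⟨hA, hQ, hB⟩ := (quasiPositive_iff_strongOrthant dyadicTable).1 quasiPositive_dyadicTable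
  have hα : InTableClass 2 dyadicTable := inTableClass_dyadicTable le_rfl
  exact orthant_not_survivingFwd_of_weightedThroughput_tendsto_zero hε hα hA hQ hB hW.isEternalVisc
    (uniformBound_of_orthant hε hα.2.1 hW hA hQ hB) hΦ

end Summit.NavierStokesRegularity.NavierStokesRegularity.Theorems.NoSurvivingEternalViscBddOne.UpwardFlux

end
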